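import Summits.ABC.IUTFork.Repair.RHReachLedgerDoorGenuine
import Summits.ABC.IUTFork.Repair.RHReachLedgerQ2
import Summits.ABC.IUTFork.Conditional.AbcOfStatementGenuineKMixChosen
import Summits.ABC.IUTFork.Cor312LicenceShallowMultiSlotGenuineKInhabited
import HarnessLib

/-!
# R-H ROUND 2 Q2(27) — the LAST ARROW: `LedgerAtDatum T ⟹ T.Cor312NonarchOf` at the CHOSEN realising ideles, and
# `RH.ReachLedgerQ2.K2Target27` EXPLICIT 1 (modulo the certified uniform dictionary on Σ₂₇)

PROOF-ONLY file (0 definitions, 0 `Prop` facts; abc-iut cell, D-0079 RESCUE sub-cell R-H, rung LADDER-ABC:A2.RESCUE.H; pair n = 10 typer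
abc-iut-rh-typ-10, author of the Q2(27) targets `Repair/RHReachLedgerQ2.lean` (p468994); coordination with abc-iut-rh2-L1 on STATUS
2026-08-26T23:5xZ–2026-08-27T00:0xZ). TAKES NO SIDE on [IUTchIII] Cor. 3.12 or on any author (Mochizuki / Scholze–Stix / Joshi / Dupuy–Hilado);
typed ≠ proved; instantiated ≠ endorsed; nothing here asserts abc proved or refuted. Row 27's ledger (`RH.ReachLedger.HStarReachLedger(K)`,
abc-iut-lens-nearmiss-1, p464022; `LedgerAtDatum`, p468994) is an R-H CANDIDATE = a HYPOTHESIS SHAPE, never asserted; the certificates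
`(e_p, A_p, B_p)` are HYPOTHESIS BINDERS (the «stratum datum»), not claimed.

THE CHAIN OF RECORD for row 27's k2 crux `K2Target27` («S|Σ₂₇ ⇒ Cor 3.12|Σ₂₇», p468994) is, after tonight's landings: (α) abc-iut-rh2-L1's
`RH.ReachLedgerRealise.levelWeightsAt_reached` (p475227, rp-d3's pooled box-free level weights) ∘ (β) abc-iut-rh-typ-10's
`RH.ReachLedgerBookkeeping` (p474654 / p474989: last-slot marginal + Situation-level minorant door) ∘ abc-iut-rh2-L1's doors
`RH.ReachLedgerDoor.statement_of_hStarReachLedger(_of_badColumns)` (p475842, at `settingPrVolSharp`) and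
`RH.ReachLedgerDoor.statement_pilotDataOfK_of_hStarReachLedgerK(_of_badColumns)` (p476084 / p476177, at the GENUINE bed `Cor312Prov.pilotDataOfK`
with REALISING ideles, dictionary binders discharged). THIS FILE adds the last arrow, per datum and globally:
* `cor312NonarchOf_of_ledgerAtDatum` — at a Θ-volume datum `T : Cor22.ThetaVolumeDatumAt P l` (every context of abc-iut-c312-7's sharp
  `K`-setting, as binders): «`LedgerAtDatum T` ∧ certified uniform dictionary ⟹ `T.Cor312NonarchOf`» — abc-iut-rh2-L1's genuine-bed door at the
  CHOSEN realising ideles (`Cor312Prov.exists_realising_{q,theta}Ideles_pilotDataOfK`), the integer q-pilot degrees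
  (`Cor312Prov.exists_nat_qPilot_pilotDataOfK`, `PilotData.qPilot_apply_of_not_mem`), `RH.ReachLedgerQ2.ledgerAtDatum_iff_hStarReachLedgerK`, and
  abc-iut-s2-p10's `GenuineKStatement.statement_chosen_iff_cor312NonarchOf` (`Statement(chosen ideles) ↔ T.Cor312NonarchOf`).
* `k2Target27_of_certificates` — `K2Target27` FOLLOWS from ONE hypothesis (explicit 1): every Σ₂₇ datum (the antecedents of `K2Target27`
  VERBATIM: admissible SZPIRO-BAD `(P, l)`, datum OFF the depth locus) carries a certified uniform dictionary. With abc-iut-rh-typ-10's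
  `abc_of_k2Target27_of_hStar27OnSigma27` (p468994): H⋆₂₇|Σ₂₇ ∧ certificates|Σ₂₇ ∧ NUM(deep ∧ bad) ∧ CONE ⟹ `ABC` — as typed implications.
THE CERTIFIED UNIFORM DICTIONARY at a datum (the residual binders of record, abc-iut-rh2-L1 23:58:16Z): per prime `p` an index `e_p` with
UNIFORM fibres `e(𝔭_x ∣ p) = e_p` for every `x ∣ p` of `K` (K/ℚ Galois rows), `A_p` with a NON-log-unit of norm `≤ p^{−(A_p−1)/e_p}` and
`B_p ≤ A_p` with a log-unit of norm `≥ p^{−B_p/e_p}` at every `x ∣ p`, and at the BAD places `innerCond p e_p ≤ A_p`, `B_p ≤ rOutSharp p e_p`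
(off the inner/outer ties: row 20's `RH.LinearReachLaw.isInnerConductor_of_not_dvd`, `RHSlotReach.exists_hrad_sharp` — NOT supplied here).
HONEST SCOPE. OUR typed objects throughout (Dupuy–Hilado (Ind2) = all `ℤ_p`-lattice automorphisms, STRONGER-THAN-PRINT; SHARP boxes; volume
reading of Step (xi)); which genuine data satisfy H⋆₂₇ (k1: 74.8 % pooled, 98.9 % on frey szpiro-bad∧window, rh-num-1) or carry the certificates
is NOT decided here; `K2Target27` stays OPEN as typed exactly at Σ₂₇ data with non-uniform fibres or tied bad primes.
[cite: Mochizuki2012, IUTchI Ex. 3.2 (iv) p. 71; IUTchIII Cor. 3.12 p. 173–174; Rmk. 3.9.3 pp. 119–120] [cite: DupuyHilado2025, §1 (1.1), §3.4, §3.9, §4.9]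
[claim: Mochizuki2012, status: disputed] for every IUT sentence quoted. Axioms: standard.
-/

noncomputable section

open Set Function NumberField IsDedekindDomain

namespace Summit.ABC.IUTFork.Repair.RH.ReachLedgerQ2

open Thm311 Thm311.Real Cor312 Cor312Vol Cor312Prov Literature.IUT.LogThetaLattice Literature.IUT.LogVolume
  Literature.IUT.HodgeTheaters Literature.IUT.LogVolume.ThetaData Summit.ABC.IUTFork.Repair.RH.ReachLedger
  Summit.ABC.IUTFork.Repair.RH.ReachLedgerDoor
open Literature.NumberTheory.DiophantineGeometry Literature.NumberTheory.DiophantineGeometry.GenEll Summit.ABC.ABC.Theorems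
  Summit.ABC.IUTFork.Conditional
open scoped Classical

section KFamily

variable
    (M : ∀ (P : NFPoint) (l : ℕ) (T : Cor22.ThetaVolumeDatumAt P l), Type) [∀ P l T, Field (M P l T)] [∀ P l T, NumberField (M P l T)]
    (archPk : ∀ (P : NFPoint) (l : ℕ) (T : Cor22.ThetaVolumeDatumAt P l), letI := T.instFieldF; letI := T.instNumberFieldF; letI := T.instAlgebraF; letI := T.instFieldK;
        letI := T.instNumberFieldK; letI := T.instAlgebraK; letI := T.instFieldFbar; letI := T.instAlgebraFbar;
        letI := T.instAlgebraKFbar; letI := T.instIsElliptic;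
      ∀ (j : (thetaIndex (pilotDataOfK T.D T.K)).Label) (vQ : (thetaIndex (pilotDataOfK T.D T.K)).VQ), Set ((logShellsDH (pilotDataOfK T.D T.K) (analyticLogv T.K)).Packet j vQ))
    (archSub : ∀ (P : NFPoint) (l : ℕ) (T : Cor22.ThetaVolumeDatumAt P l), letI := T.instFieldF; letI := T.instNumberFieldF; letI := T.instAlgebraF; letI := T.instFieldK;
        letI := T.instNumberFieldK; letI := T.instAlgebraK; letI := T.instFieldFbar; letI := T.instAlgebraFbar;
        letI := T.instAlgebraKFbar; letI := T.instIsElliptic;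
      ∀ (j : (thetaIndex (pilotDataOfK T.D T.K)).Label) (v : (thetaIndex (pilotDataOfK T.D T.K)).V), Set ((logShellsDH (pilotDataOfK T.D T.K) (analyticLogv T.K)).Packet j ((thetaIndex (pilotDataOfK T.D T.K)).over v)))
    (Ψ : ∀ (P : NFPoint) (l : ℕ) (T : Cor22.ThetaVolumeDatumAt P l), letI := T.instFieldF; letI := T.instNumberFieldF; letI := T.instAlgebraF; letI := T.instFieldK;
        letI := T.instNumberFieldK; letI := T.instAlgebraK; letI := T.instFieldFbar; letI := T.instAlgebraFbar;
        letI := T.instAlgebraKFbar; letI := T.instIsElliptic;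
      ℤ → ∀ v : (thetaIndex (pilotDataOfK T.D T.K)).V, v ∈ (thetaIndex (pilotDataOfK T.D T.K)).Vbad → Set ((logShellsDH (pilotDataOfK T.D T.K) (analyticLogv T.K)).StarPacket v))
    (act : ∀ (P : NFPoint) (l : ℕ) (T : Cor22.ThetaVolumeDatumAt P l), letI := T.instFieldF; letI := T.instNumberFieldF; letI := T.instAlgebraF; letI := T.instFieldK;
        letI := T.instNumberFieldK; letI := T.instAlgebraK; letI := T.instFieldFbar; letI := T.instAlgebraFbar;
        letI := T.instAlgebraKFbar; letI := T.instIsElliptic;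
      ℤ → ∀ v : (thetaIndex (pilotDataOfK T.D T.K)).V, v ∈ (thetaIndex (pilotDataOfK T.D T.K)).Vbad → (logShellsDH (pilotDataOfK T.D T.K) (analyticLogv T.K)).StarPacket v → Module.End ℚ ((logShellsDH (pilotDataOfK T.D T.K) (analyticLogv T.K)).StarPacket v))
    (Mmod : ∀ (P : NFPoint) (l : ℕ) (T : Cor22.ThetaVolumeDatumAt P l), letI := T.instFieldF; letI := T.instNumberFieldF; letI := T.instAlgebraF; letI := T.instFieldK;
        letI := T.instNumberFieldK; letI := T.instAlgebraK; letI := T.instFieldFbar; letI := T.instAlgebraFbar;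
        letI := T.instAlgebraKFbar; letI := T.instIsElliptic;
      ℤ → ∀ j : (thetaIndex (pilotDataOfK T.D T.K)).LabelStar, Set ((logShellsDH (pilotDataOfK T.D T.K) (analyticLogv T.K)).GlobalPacket j.1))
    (region : ∀ (P : NFPoint) (l : ℕ) (T : Cor22.ThetaVolumeDatumAt P l), letI := T.instFieldF; letI := T.instNumberFieldF; letI := T.instAlgebraF; letI := T.instFieldK;
        letI := T.instNumberFieldK; letI := T.instAlgebraK; letI := T.instFieldFbar; letI := T.instAlgebraFbar;
        letI := T.instAlgebraKFbar; letI := T.instIsElliptic;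
      ℤ → ∀ j : (thetaIndex (pilotDataOfK T.D T.K)).LabelStar, FinDivisor (M P l T) → ∀ vQ : (thetaIndex (pilotDataOfK T.D T.K)).VQ, Set ((logShellsDH (pilotDataOfK T.D T.K) (analyticLogv T.K)).Packet j.1 vQ))
    (n : ∀ (P : NFPoint) (l : ℕ) (T : Cor22.ThetaVolumeDatumAt P l), ℤ)
    {HT : ∀ (P : NFPoint) (l : ℕ) (T : Cor22.ThetaVolumeDatumAt P l), Type} {LogLink : ∀ (P : NFPoint) (l : ℕ) (T : Cor22.ThetaVolumeDatumAt P l), HT P l T → HT P l T → Type}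
    {IsFull : ∀ (P : NFPoint) (l : ℕ) (T : Cor22.ThetaVolumeDatumAt P l), ∀ {s t : HT P l T}, LogLink P l T s t → Prop}
    (lat : ∀ (P : NFPoint) (l : ℕ) (T : Cor22.ThetaVolumeDatumAt P l), LGPGaussianLogThetaLattice (LogLink P l T) (IsFull P l T))
    {Frd : ∀ (P : NFPoint) (l : ℕ) (T : Cor22.ThetaVolumeDatumAt P l), Type} {IsoF : ∀ (P : NFPoint) (l : ℕ) (T : Cor22.ThetaVolumeDatumAt P l), Frd P l T → Frd P l T → Type} {Ob : ∀ (P : NFPoint) (l : ℕ) (T : Cor22.ThetaVolumeDatumAt P l), Frd P l T → Type}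
    {realify : ∀ (P : NFPoint) (l : ℕ) (T : Cor22.ThetaVolumeDatumAt P l), Frd P l T → Frd P l T} {Strip : ∀ (P : NFPoint) (l : ℕ) (T : Cor22.ThetaVolumeDatumAt P l), Type} {IsoS : ∀ (P : NFPoint) (l : ℕ) (T : Cor22.ThetaVolumeDatumAt P l), Strip P l T → Strip P l T → Type}
    {Mv : ∀ (P : NFPoint) (l : ℕ) (T : Cor22.ThetaVolumeDatumAt P l), letI := T.instFieldF; letI := T.instNumberFieldF; letI := T.instAlgebraF; letI := T.instFieldK;
        letI := T.instNumberFieldK; letI := T.instAlgebraK; letI := T.instFieldFbar; letI := T.instAlgebraFbar;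
        letI := T.instAlgebraKFbar; letI := T.instIsElliptic;
      ∀ v : (thetaIndex (pilotDataOfK T.D T.K)).V, v ∈ (thetaIndex (pilotDataOfK T.D T.K)).Vbad → Type}
    [∀ P l T v h, Monoid (Mv P l T v h)]
    (sig : ∀ (P : NFPoint) (l : ℕ) (T : Cor22.ThetaVolumeDatumAt P l), letI := T.instFieldF; letI := T.instNumberFieldF; letI := T.instAlgebraF; letI := T.instFieldK;
        letI := T.instNumberFieldK; letI := T.instAlgebraK; letI := T.instFieldFbar; letI := T.instAlgebraFbar;
        letI := T.instAlgebraKFbar; letI := T.instIsElliptic;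
      GlobalLGPFrobenioidSignature (thetaIndex (pilotDataOfK T.D T.K)).lstar (thetaIndex (pilotDataOfK T.D T.K)).V (· ∈ (thetaIndex (pilotDataOfK T.D T.K)).Vbad) (Frd P l T) (IsoF P l T) (Ob P l T) (realify P l T)
        (Strip P l T) (IsoS P l T) (Mv P l T))
    (split : ∀ (P : NFPoint) (l : ℕ) (T : Cor22.ThetaVolumeDatumAt P l), SplittingMonoids (Mv P l T))
    {ObΔ : ∀ (P : NFPoint) (l : ℕ) (T : Cor22.ThetaVolumeDatumAt P l), Type} {N : ∀ (P : NFPoint) (l : ℕ) (T : Cor22.ThetaVolumeDatumAt P l), letI := T.instFieldF; letI := T.instNumberFieldF; letI := T.instAlgebraF; letI := T.instFieldK;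
        letI := T.instNumberFieldK; letI := T.instAlgebraK; letI := T.instFieldFbar; letI := T.instAlgebraFbar;
        letI := T.instAlgebraKFbar; letI := T.instIsElliptic;
      ∀ v : (thetaIndex (pilotDataOfK T.D T.K)).V, v ∈ (thetaIndex (pilotDataOfK T.D T.K)).Vbad → Type}
    [∀ P l T v h, Monoid (N P l T v h)] (qData : ∀ (P : NFPoint) (l : ℕ) (T : Cor22.ThetaVolumeDatumAt P l), QPilotData (ObΔ P l T) (N P l T))

include M archPk archSub Ψ act Mmod region n lat sig split qData in
/-- **`LedgerAtDatum T ⟹ T.Cor312NonarchOf` MODULO THE CERTIFIED UNIFORM DICTIONARY** (per datum; every context of abc-iut-c312-7's sharp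
`K`-setting, as binders). At a Θ-volume datum `T` whose field `K = T.K` carries, per prime `p`, a uniform index `e_p` (`e(𝔭_x ∣ p) = e_p` for every
`x ∣ p`), certificates `A_p` (a NON-log-unit of norm `≤ p^{−(A_p−1)/e_p}` at every `x ∣ p`) and `B_p ≤ A_p` (a log-unit of norm `≥ p^{−B_p/e_p}`), with
the ledger's columns dominated at the BAD places (`innerCond p e_p ≤ A_p`, `B_p ≤ rOutSharp p e_p`): row 27's ledger at the datum,
`LedgerAtDatum T` (p468994: `e = e(w∣p)`, `m_q = P_w ∈ ℕ`), implies the NUMBER-level [IUTchIII] Cor. 3.12 `T.Cor312NonarchOf` — abc-iut-rh2-L1's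
`ReachLedgerDoor.statement_pilotDataOfK_of_hStarReachLedgerK_of_badColumns` at the CHOSEN realising ideles, `ledgerAtDatum_iff_hStarReachLedgerK`,
and abc-iut-s2-p10's `GenuineKStatement.statement_chosen_iff_cor312NonarchOf`. The per-datum content of `K2Target27`; H⋆₂₇ and the certificates
are HYPOTHESES; no side taken on [IUTchIII] Cor. 3.12. [cite: Mochizuki2012, IUTchI Ex. 3.2 (iv) p. 71; IUTchIII Cor. 3.12 p. 173–174]
[cite: DupuyHilado2025, §1 (1.1), §3.4, §3.9, §4.9] [claim: Mochizuki2012, status: disputed] -/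
theorem cor312NonarchOf_of_ledgerAtDatum {P : NFPoint} {l : ℕ} (T : Cor22.ThetaVolumeDatumAt P l)
    (eK AK : Nat.Primes → ℕ) (BK : Nat.Primes → ℤ) (hBA : ∀ pp, BK pp ≤ (AK pp : ℤ))
    (hcert : letI := T.instFieldF; letI := T.instNumberFieldF; letI := T.instAlgebraF; letI := T.instFieldK;
        letI := T.instNumberFieldK; letI := T.instAlgebraK; letI := T.instFieldFbar; letI := T.instAlgebraFbar;
        letI := T.instAlgebraKFbar; letI := T.instIsElliptic;
      ∀ (pp : Nat.Primes) (x : (thetaIndex (pilotDataOfK T.D T.K)).Fibre (.inr pp)), haveI : Fact (pp : ℕ).Prime := ⟨pp.2⟩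
        (placeOf (pilotDataOfK T.D T.K) pp.1 x).asIdeal.ramificationIdx ℤ = eK pp ∧
        (∃ u : kOf (pilotDataOfK T.D T.K) pp.1 x,
          ‖u‖ ≤ (pp : ℝ) ^ (-(((AK pp : ℤ) - 1 : ℤ) : ℝ) / (eK pp : ℝ)) ∧
            u ∉ (logUnits (kOf (pilotDataOfK T.D T.K) pp.1 x) : Set (kOf (pilotDataOfK T.D T.K) pp.1 x))) ∧
        (∃ z ∈ (logUnits (kOf (pilotDataOfK T.D T.K) pp.1 x) : Set (kOf (pilotDataOfK T.D T.K) pp.1 x)),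
          ((pp : ℕ) : ℝ) ^ (-(BK pp : ℝ) / (eK pp : ℝ)) ≤ ‖z‖) ∧
        (placeOf (pilotDataOfK T.D T.K) pp.1 x ∈ (pilotDataOfK T.D T.K).S →
          innerCond pp (eK pp) ≤ (AK pp : ℤ) ∧ BK pp ≤ rOutSharp pp (eK pp)))
    (hL : LedgerAtDatum T) :
    T.Cor312NonarchOf := by
  letI := T.instFieldF; letI := T.instNumberFieldF; letI := T.instAlgebraF; letI := T.instFieldK
  letI := T.instNumberFieldK; letI := T.instAlgebraK; letI := T.instFieldFbar; letI := T.instAlgebraFbar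
  letI := T.instAlgebraKFbar; letI := T.instIsElliptic
  haveI hne : ∀ pp : Nat.Primes, Fact (pp : ℕ).Prime := fun pp => ⟨pp.2⟩
  -- `e_p ≥ 1`: the fibre over `p` is inhabited and `e(𝔭_x ∣ p) ≥ 1`
  have he : ∀ pp : Nat.Primes, 1 ≤ eK pp := fun pp => by
    obtain ⟨x, hx⟩ := (thetaIndex (pilotDataOfK T.D T.K)).fibre_nonempty (.inr pp)
    have h1 : 1 ≤ ramIdx T.K (placeOf (pilotDataOfK T.D T.K) pp.1 ⟨x, hx⟩) := RH2SigmaHull.one_le_ramIdx_placeOf T.D pp ⟨x, hx⟩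
    rw [ramIdx_eq] at h1
    exact (hcert pp ⟨x, hx⟩).1 ▸ h1
  -- the q-pilot degrees are naturals (`P_w ≥ 1` on `S`, `0` off `S`)
  have hPex : ∀ (pp : Nat.Primes) (w : (thetaIndex (pilotDataOfK T.D T.K)).Fibre (.inr pp)),
      ∃ Pw : ℕ, (pilotDataOfK T.D T.K).qPilot (placeOf (pilotDataOfK T.D T.K) pp.1 w) = Pw := by
    intro pp w
    by_cases hw : placeOf (pilotDataOfK T.D T.K) pp.1 w ∈ (pilotDataOfK T.D T.K).S
    · obtain ⟨Pw, hPw, -⟩ := exists_nat_qPilot_pilotDataOfK T.D hw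
      exact ⟨Pw, hPw⟩
    · exact ⟨0, by rw [PilotData.qPilot_apply_of_not_mem (pilotDataOfK T.D T.K) hw, Nat.cast_zero]⟩
  choose Pw hPw using hPex
  have hH : HStarReachLedgerK T.D
      (fun pp w => (placeOf (pilotDataOfK T.D T.K) pp.1 w).asIdeal.ramificationIdx ℤ) (fun pp w => (Pw pp w : ℤ)) :=
    (ledgerAtDatum_iff_hStarReachLedgerK T Pw hPw).1 hL
  have hst := statement_pilotDataOfK_of_hStarReachLedgerK_of_badColumns T.D (logvAnalytic_analyticLogv (F := T.K)) (M P l T)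
    (archPk P l T) (archSub P l T) (Ψ P l T) (act P l T) (Mmod P l T) (region P l T) (n P l T) (lat P l T) (sig P l T) (split P l T)
    (qData P l T) (exists_realising_qIdeles_pilotDataOfK T.D).choose (exists_realising_thetaIdeles_pilotDataOfK T.D).choose
    (exists_realising_qIdeles_pilotDataOfK T.D).choose_spec.1 (exists_realising_qIdeles_pilotDataOfK T.D).choose_spec.2.1
    (exists_realising_thetaIdeles_pilotDataOfK T.D).choose_spec.1 (exists_realising_thetaIdeles_pilotDataOfK T.D).choose_spec.2.1
    (exists_realising_thetaIdeles_pilotDataOfK T.D).choose_spec.2.2 (exists_realising_qIdeles_pilotDataOfK T.D).choose_spec.2.2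
    eK AK BK (fun pp w => (Pw pp w : ℤ)) he hBA (fun pp x => (hcert pp x).1) (fun pp x => (hcert pp x).2.1)
    (fun pp x => (hcert pp x).2.2.1) (fun pp w hw => ((hcert pp w).2.2.2 hw).1) (fun pp w hw => ((hcert pp w).2.2.2 hw).2)
    (fun pp w _ => by rw [Int.cast_natCast]; exact (hPw pp w).symm) hH
  exact (GenuineKStatement.statement_chosen_iff_cor312NonarchOf M archPk archSub Ψ act Mmod region n lat sig split qData T).1 hst

include M archPk archSub Ψ act Mmod region n lat sig split qData in
/-- **`K2Target27` EXPLICIT 1 — row 27's first arrow «S|Σ₂₇ ⇒ Cor 3.12|Σ₂₇» FOLLOWS from ONE hypothesis: every Σ₂₇ datum (admissible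
SZPIRO-BAD `(P, l)`, datum OFF the depth locus — the antecedents of `K2Target27` VERBATIM) carries a CERTIFIED UNIFORM DICTIONARY**
(`e_p` with `e(𝔭_x ∣ p) = e_p`, `B_p ≤ A_p` with the two witnesses per place, `innerCond ≤ A_p` and `B_p ≤ rOutSharp` at the bad places).
Then abc-iut-rh-typ-10's `abc_of_k2Target27_of_hStar27OnSigma27` (p468994) reads: H⋆₂₇|Σ₂₇ ∧ certificates|Σ₂₇ ∧ NUM(deep ∧ bad) ∧ CONE ⟹ `ABC`.
The certificate hypothesis is NOT discharged here (uniformity: `K/ℚ` Galois rows; witnesses: off the inner/outer ties); no side taken on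
[IUTchIII] Cor. 3.12; nothing asserts abc. [claim: Mochizuki2012, status: disputed] -/
theorem k2Target27_of_certificates
    (hcert : ∀ (P : NFPoint), P ∈ UP → ∀ (l : ℕ), l.Prime → 5 ≤ l →
      Cor22.AdmitsCore P → Cor22.CondP2 P l → Cor22.CondP5 P l → Cor22.CondP6 P l →
      (((l : ℝ) + 5) / 4 < (Cor22.dmod P : ℝ) ∨
        6 * l * (((l : ℝ) + 5) - 4 * Cor22.dmod P) / (((l : ℝ) + 4) * ((l : ℝ) - 3))
            * (P.logDiff + (1 - 1 / (l : ℝ)) * Cor22.logCondAvoid P {2, l})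
          + 6 * l * ((l : ℝ) + 5) / (((l : ℝ) + 4) * ((l : ℝ) - 3)) * Real.log Real.pi < Cor22.logQAvoid P {2, l}) →
      ∀ (T : Cor22.ThetaVolumeDatumAt P l), letI := T.instFieldF; letI := T.instNumberFieldF; letI := T.instAlgebraF; letI := T.instFieldK;
        letI := T.instNumberFieldK; letI := T.instAlgebraK; letI := T.instFieldFbar; letI := T.instAlgebraFbar;
        letI := T.instAlgebraKFbar; letI := T.instIsElliptic;
      ¬ (∃ (pp : Nat.Primes) (_ : 2 < (pp : ℕ)) (i : Fin (thetaIndex (pilotDataOfK T.D T.K)).lstar)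
          (x₀ : (thetaIndex (pilotDataOfK T.D T.K)).Fibre (.inr pp)),
        haveI : Fact (pp : ℕ).Prime := ⟨pp.2⟩
        ((pp : ℕ) : ℝ) ^ ((((i : ℕ) : ℝ) + 2) * (4 + 2 * Real.logb (pp : ℕ) (Module.finrank ℚ T.K)) + 1) *
          ‖(exists_realising_qIdeles_pilotDataOfK T.D).choose pp x₀‖ ^ (((i : ℕ) + 1) ^ 2 - 1) < 1) →
      ∃ (eK AK : Nat.Primes → ℕ) (BK : Nat.Primes → ℤ), (∀ pp, BK pp ≤ (AK pp : ℤ)) ∧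
        ∀ (pp : Nat.Primes) (x : (thetaIndex (pilotDataOfK T.D T.K)).Fibre (.inr pp)), haveI : Fact (pp : ℕ).Prime := ⟨pp.2⟩
          (placeOf (pilotDataOfK T.D T.K) pp.1 x).asIdeal.ramificationIdx ℤ = eK pp ∧
          (∃ u : kOf (pilotDataOfK T.D T.K) pp.1 x,
            ‖u‖ ≤ (pp : ℝ) ^ (-(((AK pp : ℤ) - 1 : ℤ) : ℝ) / (eK pp : ℝ)) ∧
              u ∉ (logUnits (kOf (pilotDataOfK T.D T.K) pp.1 x) : Set (kOf (pilotDataOfK T.D T.K) pp.1 x))) ∧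
          (∃ z ∈ (logUnits (kOf (pilotDataOfK T.D T.K) pp.1 x) : Set (kOf (pilotDataOfK T.D T.K) pp.1 x)),
            ((pp : ℕ) : ℝ) ^ (-(BK pp : ℝ) / (eK pp : ℝ)) ≤ ‖z‖) ∧
          (placeOf (pilotDataOfK T.D T.K) pp.1 x ∈ (pilotDataOfK T.D T.K).S →
            innerCond pp (eK pp) ≤ (AK pp : ℤ) ∧ BK pp ≤ rOutSharp pp (eK pp))) :
    K2Target27 := by
  intro P hP l hl h5 hc h2 h5' h6 hbad T hwin hL
  obtain ⟨eK, AK, BK, hBA, hc'⟩ := hcert P hP l hl h5 hc h2 h5' h6 hbad T hwin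
  exact cor312NonarchOf_of_ledgerAtDatum M archPk archSub Ψ act Mmod region n lat sig split qData T eK AK BK hBA hc' hL

end KFamily

end Summit.ABC.IUTFork.Repair.RH.ReachLedgerQ2

end
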